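import Summits.CriticalPhenomena.CardyFormulaZ2.Theorems.CardySusyWardWeakHolomorphySpinShift
import Summits.CriticalPhenomena.CardyFormulaZ2.Theorems.CardySusyWardWeakHolomorphyReduction

/-!
# The spin-`−5/3` alias of the dart observable satisfies the vertex relation of the OPPOSITE chirality, exactly

Line `Sketch` of the crux `CardySusyWard.WeakHolomorphy` (stmt-CriticalPhenomena-11292), lead c3 (infrastructure,
`--supports`).  Corner by corner, the spin-`−5/3` dart observable of admissible data is the spin-`1/3` one re-signed by the
corner parity: `F^{(−5/3)}(c_{p,k}) = (−1)^{k + c₀.2} F^{(1/3)}(c_{p,k})` (`alias_corner_eq`; pathwise `signed_dartPhaseSum_third_eq`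
of `…SpinShift`, the coded index of the `k`-th clockwise corner having the parity of `k`).  Since the half-Cauchy–Riemann
coefficients obey `coeff(−i)_k (−1)^k = coeff(i)_k`, the EXACT vertex relation of chirality `+i` for `F^{(1/3)}` at interior
vertices of hole-free admissible data (`stub_halfCR`, Duminil-Copin 2012 Prop. 4) is, for the alias, the exact vertex relation
of chirality `−i`: `halfCRForm (−i) p F^{(−5/3)} = 0` (`alias_halfCR_conj`).  So the crux in its alias normal form
(`weakHolomorphy_iff_alias`) concerns a lattice observable carrying the KNOWN half of discrete Cauchy–Riemann of the conjugate
chirality — the "anti-holomorphic partner" of the percolation parafermion; its weak vanishing at the spin-`1/3` scale is the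
missing dual half.  References: Duminil-Copin arXiv:1208.3787 Prop. 4; Duminil-Copin–Smirnov arXiv:1109.1549 §8.3.
-/

noncomputable section

namespace Summit.CriticalPhenomena.CardyFormulaZ2.Theorems.WeakHolomorphy.SplitBypass

open scoped BigOperators
open MeasureTheory Complex
open _root_.Literature.Probability.LatticeModels
open _root_.Literature.Probability.Percolation (BondConfig bondPercolation half)
open _root_.Literature.Barriers.CriticalPhenomena (medialCornersAt medialVertexOf halfCRForm HalfCRRelationAt
  halfCRForm_apply halfCRRelationAt_iff)
open _root_.Literature.Barriers.CriticalPhenomena.HalfCRGreen (coeff)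
open _root_.Literature.Probability.LatticeModels.DiscreteDobrushin (startCorner exitTime medialExploration_eq_explorationList)
open Summit.CriticalPhenomena.CardyFormulaZ2.Cruxes.EdgePrecompact.QkzStripBoundaryArm (cornerObs cornerObs_eq_bondDartObservable)

variable {E : DiscreteDobrushin}

/-- **The alias corner by corner**: for admissible data, at every medial vertex `p`, every clockwise corner `k` and every reading
mesh `δ ≠ 0`, `F^{(−5/3)}(c_{p,k}) = (−1)^{k + c₀.2} · F^{(1/3)}(c_{p,k})` (`c₀` the start corner). [folklore] -/
theorem alias_corner_eq (hE : E.IsZdAdmissible) (p : Site 2 × Fin 2) (k : Fin 4) {δ : ℝ} (hδ : δ ≠ 0) :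
    bondDartObservable E δ (-5 / 3) (medialCornersAt p.1 p.2 k) =
      (-1 : ℂ) ^ (k.val + (startCorner hE).2.val) * bondDartObservable E δ (1 / 3) (medialCornersAt p.1 p.2 k) := by
  classical
  have hpath : ∀ ω, Parafermion.dartPhaseSum (medialExploration E ω) δ (-5 / 3) (medialCornersAt p.1 p.2 k) =
      (-1 : ℂ) ^ (k.val + (startCorner hE).2.val) *
        Parafermion.dartPhaseSum (medialExploration E ω) δ (1 / 3) (medialCornersAt p.1 p.2 k) := by
    intro ω
    rw [medialExploration_eq_explorationList hE ω]
    -- the clockwise corner `k` at `p` as a coded corner `r` with `r.2 ≡ k (mod 2)`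
    obtain ⟨r, hr, hpar⟩ : ∃ r : Site 2 × Fin 4, medialCornersAt p.1 p.2 k = (r.1, cFace r) ∧
        (-1 : ℂ) ^ r.2.val = (-1) ^ k.val := by
      obtain ⟨x, i⟩ := p
      obtain rfl | rfl : i = 0 ∨ i = 1 := by fin_cases i <;> simp
      · fin_cases k
        · exact ⟨(x, 0), by simp [medialCornersAt, cFace, faceAt, cornerOff], rfl⟩
        · exact ⟨(x + Pi.single 0 1, 1), by simp [medialCornersAt, cFace, faceAt, cornerOff], rfl⟩
        · exact ⟨(x + Pi.single 0 1, 2), by simp [medialCornersAt, cFace, faceAt, cornerOff]; abel, rfl⟩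
        · exact ⟨(x, 3), by simp [medialCornersAt, cFace, faceAt, cornerOff], rfl⟩
      · fin_cases k
        · exact ⟨(x + Pi.single 1 1, 2), by simp [medialCornersAt, cFace, faceAt, cornerOff], by norm_num⟩
        · exact ⟨(x + Pi.single 1 1, 3), by simp [medialCornersAt, cFace, faceAt, cornerOff], by norm_num⟩
        · exact ⟨(x, 0), by simp [medialCornersAt, cFace, faceAt, cornerOff], by norm_num⟩
        · exact ⟨(x, 1), by simp [medialCornersAt, cFace, faceAt, cornerOff], by norm_num⟩
    rw [hr, ← signed_dartPhaseSum_third_eq hδ, pow_add, pow_add, hpar]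
  simp only [Parafermion.bondDartObservable_def, hpath, integral_const_mul]

/-- `coeff(−i)_k · (−1)^k = coeff(i)_k` for the four half-Cauchy–Riemann coefficients `(1, −c, −1, c)`. [folklore] -/
theorem coeff_negI_mul_neg_one_pow (k : Fin 4) : coeff (-Complex.I) k * (-1) ^ k.val = coeff Complex.I k := by
  fin_cases k
  · simp [coeff]
  · simp [coeff]
  · simp [coeff]
  · simp [coeff]; ring

/-- **The alias satisfies the exact vertex relation of the conjugate chirality.** At an interior medial vertex of hole-free
`ℤ²`-admissible Dobrushin data, `halfCRForm (−i) p F^{(−5/3)} = 0` for `F^{(−5/3)} = bondDartObservable E δ (−5/3)`, because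
`halfCRForm i p F^{(1/3)} = 0` (`stub_halfCR`) and the alias re-signs corner `k` by `(−1)^k`.
[cite: DuminilCopin2012Parafermion, Proposition 4] -/
theorem alias_halfCR_conj (hE : E.IsZdAdmissible) (hH : HoleFree {f : Site 2 | E.IsInnerFace f})
    (p : Site 2 × Fin 2) (hp : medialVertexOf p ∈ (discreteDomainGraph E.Ω E.δ).edgeSet ∧
      (∀ x ∈ medialVertexOf p, x ∉ E.zdArcA ∧ x ∉ E.zdArcB) ∧
      ∀ f : Site 2, IsCorner p.1 f → IsCorner (p.1 + Pi.single p.2 1) f → E.IsInnerFace f) {δ : ℝ} (hδ : 0 < δ) :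
    halfCRForm (-Complex.I) p (fun c => bondDartObservable E δ (-5 / 3) c) = 0 := by
  -- the exact chirality-`+i` relation for the spin-`1/3` observable
  have h := stub_halfCR E hE hH p hp δ hδ
  rw [halfCRRelationAt_iff] at h
  have hfun : (fun c : Site 2 × Site 2 => cornerObs E δ c.1 c.2) = fun c => bondDartObservable E δ (1 / 3) c := by
    funext c; rw [cornerObs_eq_bondDartObservable]
  rw [hfun, _root_.Literature.Barriers.CriticalPhenomena.HalfCRGreen.halfCRForm_eq_sum] at h
  rw [_root_.Literature.Barriers.CriticalPhenomena.HalfCRGreen.halfCRForm_eq_sum]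
  have hterm : ∀ k : Fin 4, coeff (-Complex.I) k * bondDartObservable E δ (-5 / 3) (medialCornersAt p.1 p.2 k) =
      (-1 : ℂ) ^ (startCorner hE).2.val * (coeff Complex.I k * bondDartObservable E δ (1 / 3) (medialCornersAt p.1 p.2 k)) := by
    intro k
    rw [alias_corner_eq hE p k hδ.ne', pow_add, ← coeff_negI_mul_neg_one_pow k]
    ring
  simp only [hterm, ← Finset.mul_sum, h, mul_zero]

/-- **Registered one-line form of `alias_halfCR_conj`**: the spin-`−5/3` dart observable of hole-free admissible data satisfies
the EXACT vertex relation of chirality `−i` at every interior medial vertex (the conjugate of Duminil-Copin's relation for the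
spin-`1/3` observable). [cite: DuminilCopin2012Parafermion, Proposition 4] -/
theorem stub_aliasHalfCRConj : ∀ (E : DiscreteDobrushin), E.IsZdAdmissible → HoleFree {f : Site 2 | E.IsInnerFace f} → ∀ p : Site 2 × Fin 2, (medialVertexOf p ∈ (discreteDomainGraph E.Ω E.δ).edgeSet ∧ (∀ x ∈ medialVertexOf p, x ∉ E.zdArcA ∧ x ∉ E.zdArcB) ∧ ∀ f : Site 2, IsCorner p.1 f → IsCorner (p.1 + Pi.single p.2 1) f → E.IsInnerFace f) → ∀ δ : ℝ, 0 < δ → halfCRForm (-Complex.I) p (fun c => bondDartObservable E δ (-5 / 3) c) = 0 :=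
  fun _ hE hH p hp _ hδ => alias_halfCR_conj hE hH p hp hδ

end Summit.CriticalPhenomena.CardyFormulaZ2.Theorems.WeakHolomorphy.SplitBypass

end
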